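import Summits.KontsevichZagierPeriods.Zeta5Search.Barrier.ConeGammaS7Cocycle

/-!
# ζ(5) search — BARRIER: LEMMA F — a separable majorant of the saving step function bounds `Φ` in closed form

HONEST FRAMING (cell `pub-zeta5`): systematic search; no irrationality claim unless kernel-certified. MODEL objects
under Brown–Zudilin's (28)+(30) accounting ([BZ22] = arXiv:2210.03391; (28) observed, not proved): an explicit
elementary UPPER BOUND for BZ's MODEL saving rate `Φ = phi30` obtained by integrating a SEPARABLE majorant of the
saving exponent `N_a(u)` along the flow `u ↦ u·s(a)`. Nothing here is a statement about `γ`, the cone's supremum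
(C2 OPEN), S-E (CONJECTURED) or `ζ(5)`; no number or sentence of record moves; records in print UNMOVED. Prover P2 g24
(item «LEMMA F IN THE KERNEL» = cert-2 g33's successor menu (d), the lead's standing word INBOX l.9160 / l.9174;
memo `cert-2/g32/SEP-MAJORANT.md` §1 LEMMA F), file 1/2 (the abstract lemma; file 2/2 `ConeGammaLemmaF7` instantiates
it with the tree theorems `torusN_le_F7` / `torusN_le_F6`).

**LEMMA F (abstract, closed form).** Let `a` be a direction of the closed box, `H > 0` with all 28 forms `h_k(a) ≤ H`,
and let `(ε_m, x_m)_{m ∈ M}` be a finite family with `0 ≤ x_m ≤ H` and `Σ_m ε_m x_m = 0` such that along the flow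
`N_a(u) ≤ c + Σ_m ε_m·{u·x_m}` for `u ≥ 1/H` (`{·}` = fractional part). Then
**`Φ(a) ≤ c·H + Σ_m ε_m·x_m·log(H/x_m)`** (`phi30_le_of_sepBound`; normalised form `H = 1`:
`Φ(a) ≤ c − Σ_m ε_m x_m log x_m`, `phi30_le_of_sepBound_one`).
PROOF. `N_a ≡ 0` on `(0, 1/H)` (all 28 floors vanish: `savingN_eq_zero_of_forall_lt_one`, sharper than the tree's
`savingN_eq_zero_of_small`); for `u ≥ 1/H` the linear parts cancel, `c + Σ ε_m{u x_m} = c − Σ ε_m(⌊u x_m⌋ − x_m⌊u⌋)`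
(at `H = 1`), the defects vanish on `(0,1)` as well, so `Φ(a) = ∫_{(1,∞)} N_a u⁻² ≤ c − Σ_m ε_m ∫_{(0,∞)}(⌊u x_m⌋ −
x_m⌊u⌋)u⁻² du = c − Σ_m ε_m x_m log x_m` by P2 g20's `integral_Ioi_floorDefect`; general `H` by the degree-1
homogeneity `phi30_smul`. REMARK (the memo's form). cert-2 g32 writes the bound as `1/u₀ + Σ_m ε_m x_m λ(u₀x_m)` with
`λ(L) = ∫_L^∞ {w}w⁻² dw`; since `Σ ε_m x_m = 0` the constant `λ(1) = 1 − γ_E` drops out and the closed form above IS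
that bound (checked on all twelve rows of the memo's §0 (R3) table to the printed 10 digits, seat file `alg/bcheck.py`) —
no Euler constant and no special function enter the kernel.

* `torusN_eq_zero_of_floor`, `savingN_eq_zero_of_forall_lt_one` — `𝒩 = 0` / `N_a(u) = 0` below the first wall;
* `BZBox_smul` — the closed box is a cone;
* `setIntegral_Ioi_eq_Ioi_one` — `∫_{(0,∞)} f = ∫_{(1,∞)} f` for `f ≡ 0` on `(0,1)`;
* `sepBound_eq_defect` — the pointwise identity `c + Σ ε_m{u x_m} = c − Σ ε_m(⌊u x_m⌋ − x_m⌊u⌋)`;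
* **`phi30_le_of_sepBound_one`**, **`phi30_le_of_sepBound`** — LEMMA F.
-/

noncomputable section

open Set MeasureTheory Filter
open scoped Topology

namespace Summit.KontsevichZagierPeriods.Zeta5Search.Barrier.ConeGamma

/-! ### `𝒩 = 0` below the first wall; the box is a cone -/

/-- If every off-diagonal pair form of `θ` has integer part `0`, then `𝒩(θ) = 0` (every floor in every `torusTerm`
vanishes). -/
theorem torusN_eq_zero_of_floor {θ : Fin 8 → ℝ} (h : ∀ i j : Fin 8, i ≠ j → ⌊pairForm θ i j⌋ = 0) :
    torusN θ = 0 := by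
  refine le_antisymm ?_ (torusN_nonneg θ)
  unfold torusN
  refine Finset.sup'_le _ _ fun σ _ => le_of_eq ?_
  unfold torusTerm
  refine Finset.sum_eq_zero fun k _ => ?_
  rw [phiForm_permS, phiForm_eq, h _ _ (fstIdx_ne_sndIdx k),
    h _ _ ((liftPerm σ).injective.ne (fstIdx_ne_sndIdx k)), sub_self]

/-- **`N_a(u) = 0` below the first wall**: on the closed box, if `0 ≤ u` and `u·h_k(a) < 1` for all 28 forms, then
`N_a(u) = 0` (sharper than `savingN_eq_zero_of_small`, which asks `2s₀·u < 1`). -/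
theorem savingN_eq_zero_of_forall_lt_one {a : Dir} (ha : BZBox a) {u : ℝ} (hu0 : 0 ≤ u)
    (hu : ∀ k : Fin 28, u * h28 a k < 1) : savingN a u = 0 := by
  rw [savingN_eq_torusN_of_BZBox ha]
  apply torusN_eq_zero_of_floor
  have key : ∀ i j : Fin 8, i < j → ⌊pairForm (u • sParam a) i j⌋ = 0 := by
    intro i j hij
    rw [pairForm_eq_phiForm_idxOf _ hij, phiForm_smul_sParam, Int.floor_eq_zero_iff]
    exact ⟨mul_nonneg hu0 (h28_nonneg_of_BZBox ha _), hu _⟩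
  intro i j hij
  rcases lt_or_gt_of_ne hij with h | h
  · exact key i j h
  · rw [pairForm_comm]; exact key j i h

/-- The closed box is invariant under positive dilations. -/
theorem BZBox_smul {t : ℝ} (ht : 0 < t) {a : Dir} (ha : BZBox a) : BZBox (t • a) := by
  obtain ⟨h0, hj⟩ := ha
  refine ⟨?_, fun j => ⟨?_, ?_⟩⟩
  · simpa [sParam_smul] using mul_pos ht h0
  · simpa [sParam_smul] using mul_nonneg ht.le (hj j).1
  · simpa [sParam_smul] using mul_le_mul_of_nonneg_left (hj j).2 ht.le

/-! ### Two integration helpers -/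

/-- `∫_{(0,∞)} f = ∫_{(1,∞)} f` for an integrable `f` vanishing on `(0,1)`. -/
theorem setIntegral_Ioi_eq_Ioi_one {f : ℝ → ℝ} (hf : IntegrableOn f (Ioi 0))
    (h0 : ∀ u ∈ Ioo (0 : ℝ) 1, f u = 0) : ∫ u in Ioi (0 : ℝ), f u = ∫ u in Ioi (1 : ℝ), f u := by
  have hsplit : Ioi (0 : ℝ) = Ioo 0 1 ∪ Ici 1 := (Ioo_union_Ici_eq_Ioi zero_lt_one).symm
  have hdisj : Disjoint (Ioo (0 : ℝ) 1) (Ici 1) := by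
    rw [Set.disjoint_left]
    intro u hu hu'
    exact absurd hu.2 (not_lt.mpr hu')
  rw [hsplit, setIntegral_union hdisj measurableSet_Ici (hf.mono_set Ioo_subset_Ioi_self)
    (hf.mono_set (Ici_subset_Ioi.mpr zero_lt_one)), setIntegral_eq_zero_of_forall_eq_zero h0, zero_add,
    integral_Ici_eq_integral_Ioi]

/-- `u ↦ c/u²` is integrable on `(1, ∞)` with integral `c`. -/
theorem integral_Ioi_one_const_div_sq (c : ℝ) :
    IntegrableOn (fun u : ℝ => c / u ^ 2) (Ioi 1) ∧ ∫ u in Ioi (1 : ℝ), c / u ^ 2 = c := by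
  have heq : EqOn (fun u : ℝ => c * u ^ (-2 : ℝ)) (fun u : ℝ => c / u ^ 2) (Ioi 1) := by
    intro u hu
    have hu0 : 0 ≤ u := zero_le_one.trans (le_of_lt hu)
    simp only [Real.rpow_neg hu0, Real.rpow_two, div_eq_mul_inv]
  have hint : IntegrableOn (fun u : ℝ => c * u ^ (-2 : ℝ)) (Ioi 1) :=
    (integrableOn_Ioi_rpow_of_lt (by norm_num : (-2 : ℝ) < -1) zero_lt_one).const_mul c
  refine ⟨hint.congr_fun heq measurableSet_Ioi, ?_⟩
  rw [← setIntegral_congr_fun measurableSet_Ioi heq, integral_const_mul,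
    integral_Ioi_rpow_of_lt (by norm_num : (-2 : ℝ) < -1) zero_lt_one]
  norm_num

/-! ### LEMMA F -/

/-- **The linear parts cancel.** If `Σ_m ε_m x_m = 0` then, for every `u`,
`c + Σ_m ε_m {u x_m} = c − Σ_m ε_m (⌊u x_m⌋ − x_m ⌊u⌋)`. -/
theorem sepBound_eq_defect {ι : Type*} (M : Finset ι) (ε x : ι → ℝ) (c : ℝ)
    (hlin : ∑ m ∈ M, ε m * x m = 0) (u : ℝ) :
    c + ∑ m ∈ M, ε m * Int.fract (u * x m) = c - ∑ m ∈ M, ε m * ((⌊u * x m⌋ : ℝ) - x m * ⌊u⌋) := by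
  have h1 : ∑ m ∈ M, ε m * Int.fract (u * x m) =
      u * ∑ m ∈ M, ε m * x m - ∑ m ∈ M, ε m * (⌊u * x m⌋ : ℝ) := by
    rw [Finset.mul_sum, ← Finset.sum_sub_distrib]
    refine Finset.sum_congr rfl fun m _ => ?_
    unfold Int.fract
    ring
  have h2 : ∑ m ∈ M, ε m * ((⌊u * x m⌋ : ℝ) - x m * ⌊u⌋) =
      ∑ m ∈ M, ε m * (⌊u * x m⌋ : ℝ) - ⌊u⌋ * ∑ m ∈ M, ε m * x m := by
    rw [Finset.mul_sum, ← Finset.sum_sub_distrib]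
    refine Finset.sum_congr rfl fun m _ => ?_
    ring
  rw [h1, h2, hlin]
  ring

/-- **LEMMA F, normalised form (`H = 1`).** For `a` in the closed box with all 28 forms `h_k(a) ≤ 1`, a finite family
`(ε_m, x_m)` with `0 ≤ x_m ≤ 1`, `Σ_m ε_m x_m = 0`, and a separable bound `N_a(u) ≤ c + Σ_m ε_m {u x_m}` for `u ≥ 1`:
**`Φ(a) ≤ c − Σ_m ε_m x_m log x_m`**. -/
theorem phi30_le_of_sepBound_one {a : Dir} (ha : BZBox a) (hh : ∀ k : Fin 28, h28 a k ≤ 1)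
    {ι : Type*} (M : Finset ι) (ε x : ι → ℝ) (c : ℝ)
    (hx0 : ∀ m ∈ M, 0 ≤ x m) (hx1 : ∀ m ∈ M, x m ≤ 1) (hlin : ∑ m ∈ M, ε m * x m = 0)
    (hN : ∀ u : ℝ, 1 ≤ u → (savingN a u : ℝ) ≤ c + ∑ m ∈ M, ε m * Int.fract (u * x m)) :
    phi30 a ≤ c - ∑ m ∈ M, ε m * (x m * Real.log (x m)) := by
  -- the defect integrands, their integrals over `(1, ∞)`
  set D : ι → ℝ → ℝ := fun m u => ((⌊u * x m⌋ : ℝ) - x m * ⌊u⌋) / u ^ 2 with hD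
  have hDint : ∀ m ∈ M, IntegrableOn (D m) (Ioi 1) := fun m hm =>
    (integrableOn_floorDefect (hx0 m hm)).mono_set (Ioi_subset_Ioi zero_le_one)
  have hDval : ∀ m ∈ M, ∫ u in Ioi (1 : ℝ), D m u = x m * Real.log (x m) := by
    intro m hm
    rw [← integral_Ioi_floorDefect (hx0 m hm)]
    refine (setIntegral_Ioi_eq_Ioi_one (integrableOn_floorDefect (hx0 m hm)) fun u hu => ?_).symm
    have hux : u * x m < 1 := lt_of_le_of_lt (mul_le_of_le_one_right hu.1.le (hx1 m hm)) hu.2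
    rw [floor_mul_sub_mul_floor_eq_zero (hx0 m hm) hu.1.le hu.2 hux, zero_div]
  -- `Φ(a) = ∫_{(1,∞)} N_a u⁻²`
  have hphi : phi30 a = ∫ u in Ioi (1 : ℝ), (savingN a u : ℝ) / u ^ 2 := by
    unfold phi30
    refine setIntegral_Ioi_eq_Ioi_one (integrableOn_savingN_div_sq ha) fun u hu => ?_
    have hk : ∀ k : Fin 28, u * h28 a k < 1 := fun k =>
      lt_of_le_of_lt (mul_le_of_le_one_right hu.1.le (hh k)) hu.2
    rw [savingN_eq_zero_of_forall_lt_one ha hu.1.le hk, Int.cast_zero, zero_div]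
  -- the majorant `g = c/u² − Σ ε_m D_m` on `(1, ∞)`
  obtain ⟨hcint, hcval⟩ := integral_Ioi_one_const_div_sq c
  have hsum_int : IntegrableOn (fun u : ℝ => ∑ m ∈ M, ε m * D m u) (Ioi 1) :=
    integrable_finsetSum M fun m hm => (hDint m hm).const_mul (ε m)
  have hpt : ∀ u ∈ Ioi (1 : ℝ), (savingN a u : ℝ) / u ^ 2 ≤ c / u ^ 2 - ∑ m ∈ M, ε m * D m u := by
    intro u hu
    have hu1 : (1 : ℝ) ≤ u := le_of_lt hu
    have h := div_le_div_of_nonneg_right (hN u hu1) (sq_nonneg u)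
    rw [sepBound_eq_defect M ε x c hlin u, sub_div, Finset.sum_div] at h
    simpa only [hD, mul_div_assoc] using h
  rw [hphi]
  calc ∫ u in Ioi (1 : ℝ), (savingN a u : ℝ) / u ^ 2
      ≤ ∫ u in Ioi (1 : ℝ), (c / u ^ 2 - ∑ m ∈ M, ε m * D m u) :=
        setIntegral_mono_on ((integrableOn_savingN_div_sq ha).mono_set (Ioi_subset_Ioi zero_le_one))
          (hcint.sub hsum_int) measurableSet_Ioi hpt
    _ = c - ∑ m ∈ M, ε m * (x m * Real.log (x m)) := by
        rw [integral_sub hcint hsum_int, hcval, integral_finsetSum M fun m hm => (hDint m hm).const_mul (ε m)]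
        congr 1
        refine Finset.sum_congr rfl fun m hm => ?_
        rw [integral_const_mul, hDval m hm]

/-- **LEMMA F (cert-2 g32, SEP-MAJORANT §1), closed form.** For `a` in the closed box, `H > 0` with all 28 forms
`h_k(a) ≤ H`, a finite family `(ε_m, x_m)` with `0 ≤ x_m ≤ H` and `Σ_m ε_m x_m = 0`, and a separable bound along the
flow `N_a(u) ≤ c + Σ_m ε_m {u x_m}` for `u ≥ 1/H`: **`Φ(a) ≤ c·H + Σ_m ε_m x_m log(H/x_m)`** — an explicit
elementary function of the direction (no period, no rationality). -/
theorem phi30_le_of_sepBound {a : Dir} (ha : BZBox a) {H : ℝ} (hH : 0 < H) (hh : ∀ k : Fin 28, h28 a k ≤ H)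
    {ι : Type*} (M : Finset ι) (ε x : ι → ℝ) (c : ℝ)
    (hx0 : ∀ m ∈ M, 0 ≤ x m) (hxH : ∀ m ∈ M, x m ≤ H) (hlin : ∑ m ∈ M, ε m * x m = 0)
    (hN : ∀ u : ℝ, 1 / H ≤ u → (savingN a u : ℝ) ≤ c + ∑ m ∈ M, ε m * Int.fract (u * x m)) :
    phi30 a ≤ c * H + ∑ m ∈ M, ε m * (x m * Real.log (H / x m)) := by
  -- normalise: `a' = H⁻¹ • a`
  set a' : Dir := H⁻¹ • a with ha'
  have hHi : 0 < H⁻¹ := inv_pos.mpr hH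
  have hbox : BZBox a' := BZBox_smul hHi ha
  have hh' : ∀ k : Fin 28, h28 a' k ≤ 1 := fun k => by
    rw [ha', h28_smul, Pi.smul_apply, smul_eq_mul, inv_mul_le_iff₀ hH, mul_one]
    exact hh k
  have hx0' : ∀ m ∈ M, 0 ≤ x m / H := fun m hm => div_nonneg (hx0 m hm) hH.le
  have hx1' : ∀ m ∈ M, x m / H ≤ 1 := fun m hm => (div_le_one hH).mpr (hxH m hm)
  have hlin' : ∑ m ∈ M, ε m * (x m / H) = 0 := by
    have : ∑ m ∈ M, ε m * (x m / H) = (∑ m ∈ M, ε m * x m) / H := by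
      rw [Finset.sum_div]
      refine Finset.sum_congr rfl fun m _ => ?_
      ring
    rw [this, hlin, zero_div]
  have hN' : ∀ u : ℝ, 1 ≤ u → (savingN a' u : ℝ) ≤ c + ∑ m ∈ M, ε m * Int.fract (u * (x m / H)) := by
    intro u hu
    rw [ha', savingN_smul hHi]
    have hu' : 1 / H ≤ H⁻¹ * u := by
      rw [one_div]; exact le_mul_of_one_le_right hHi.le hu
    have h := hN (H⁻¹ * u) hu'
    have heq : ∀ m, H⁻¹ * u * x m = u * (x m / H) := fun m => by ring
    simpa only [heq] using h
  have h1 := phi30_le_of_sepBound_one hbox hh' M ε (fun m => x m / H) c hx0' hx1' hlin' hN'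
  -- scale back
  have hscale : phi30 a = H * phi30 a' := by
    rw [← phi30_smul hH, ha', smul_smul, mul_inv_cancel₀ hH.ne', one_smul]
  rw [hscale]
  have hH0 : H ≠ 0 := hH.ne'
  have hlog : ∀ m, x m / H * Real.log (x m / H) = -(x m * Real.log (H / x m)) / H := fun m => by
    have h : Real.log (x m / H) = -Real.log (H / x m) := by rw [← Real.log_inv, inv_div]
    rw [h]
    ring
  have hterm : ∀ m ∈ M, H * (ε m * (-(x m * Real.log (H / x m)) / H)) = -(ε m * (x m * Real.log (H / x m))) := by
    intro m _
    rw [mul_div_assoc', mul_div_assoc', mul_div_cancel_left₀ _ hH0, mul_neg]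
  calc H * phi30 a' ≤ H * (c - ∑ m ∈ M, ε m * (x m / H * Real.log (x m / H))) :=
        mul_le_mul_of_nonneg_left h1 hH.le
    _ = c * H + ∑ m ∈ M, ε m * (x m * Real.log (H / x m)) := by
        simp only [hlog]
        rw [mul_sub, Finset.mul_sum, Finset.sum_congr rfl hterm, Finset.sum_neg_distrib]
        ring

end Summit.KontsevichZagierPeriods.Zeta5Search.Barrier.ConeGamma

end
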